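import Summits.Ventures.HSemireg.WeilFamilyStableSubspaces
import Mathlib.LinearAlgebra.Complex.FiniteDimensional
import HarnessLib

/-!
# Venture HSemireg — the orbit of ONE vector under the Weil-family tangent space (LEMMA P′)

Companion to `WeilFamilyStableSubspaces` (same vocabulary: `U = P × P`, tangent directions
`offDiag (rankOne w v) (x₁, x₂) = (⟪w, x₂⟫ v, ⟪v, x₁⟫ w)` of van Geemen's family, LNM 1594 §5.3–5.6).
There the hypothesis was that a subgroup `W` is STABLE under all directions; here only the orbit of a
single non-zero vector `s ∈ W` is assumed to stay in `W`, and the conclusion is a LOWER BOUND on the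
size of `W`:

* `inl_mem_of_inner_eq_zero` / `inr_mem_of_inner_eq_zero`: if `s = (s₁, s₂) ∈ W` with `s₂ ≠ 0`
  (resp. `s₁ ≠ 0`) and `T_{|w⟩⟨v|} s ∈ W` for all `w, v`, then `(y, 0) ∈ W` for every `y ⊥ s₁`
  (resp. `(0, y) ∈ W` for every `y ⊥ s₂`); `inr_mem_of_snd_eq_zero` / `inl_mem_of_fst_eq_zero`: if
  `s₂ = 0 ≠ s₁` then `0 ⊕ P ⊆ W` (and symmetrically);
* `finrank_ge_of_orbit_subset` (**LEMMA P′**): for `dim_ℂ P = n ≥ 2`, a real subspace `W ∋ s ≠ 0`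
  containing the orbit `𝔭 · s` has `dim_ℝ W ≥ 2n + 1`.

HONEST FRAMING. Elementary linear algebra; Lean index of the computation cell `pub-hsemireg`, seat
`w1-tw-1` (W1), note `widen/W1/CLEAN-FLAT-THEOREM-w1tw1.md` §13 (CLEAN-FLAT III «uncut direction»):
there `W = H₁(B₀, ℝ)` for a flat `B` of dimension `≤ n` (so `dim_ℝ W ≤ 2n`) and `s` spans a common
direction of the subflats along which `B` is glued; the bound `2n + 1` is the contradiction. The
dictionary (Weil directions = `𝔭`, obstruction to lifting a flat = stability of `H₁`) is NOT constructed
here; no abelian variety, Hodge class or semiregularity map appears in this file; nothing here says that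
HC, HC_CM or HC_AV holds, and nothing here is a new case of anything.
-/

noncomputable section

open Complex Module
open scoped InnerProductSpace ComplexConjugate

namespace Summit.Ventures.HSemireg

namespace WeilFamily

open Literature.AlgebraicGeometry.HodgeTheory.WeilFamily

variable {P : Type*} [NormedAddCommGroup P] [InnerProductSpace ℂ P] [FiniteDimensional ℂ P]

/-! ### Membership consequences of `𝔭 · s ⊆ W` -/

section Orbit

variable (W : AddSubgroup (P × P)) {s : P × P}
  (hW : ∀ w v : P, offDiag (rankOne w v) s ∈ W)
include hW

/-- If `s₂ ≠ 0`, every `(y, 0)` with `y ⊥ s₁` lies in `W`: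
`T_{|s₂⟩⟨y'|} s = (‖s₂‖² y', ⟪y', s₁⟫ s₂) = (y, 0)` for `y' = ‖s₂‖⁻² y`. [folklore] -/
theorem inl_mem_of_inner_eq_zero (hs₂ : s.2 ≠ 0) {y : P} (hy : ⟪y, s.1⟫_ℂ = 0) :
    ((y, (0 : P)) : P × P) ∈ W := by
  have h := hW s.2 ((((‖s.2‖ ^ 2)⁻¹ : ℝ) : ℂ) • y)
  rw [offDiag_rankOne_apply, inner_smul_left, hy, mul_zero, zero_smul,
    inner_self_smul_inv_norm_sq_smul hs₂] at h
  exact h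

/-- If `s₁ ≠ 0`, every `(0, y)` with `y ⊥ s₂` lies in `W`:
`T_{|y'⟩⟨s₁|} s = (⟪y', s₂⟫ s₁, ‖s₁‖² y') = (0, y)` for `y' = ‖s₁‖⁻² y`. [folklore] -/
theorem inr_mem_of_inner_eq_zero (hs₁ : s.1 ≠ 0) {y : P} (hy : ⟪y, s.2⟫_ℂ = 0) :
    (((0 : P), y) : P × P) ∈ W := by
  have h := hW ((((‖s.1‖ ^ 2)⁻¹ : ℝ) : ℂ) • y) s.1
  rw [offDiag_rankOne_apply, inner_smul_left, hy, mul_zero, zero_smul,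
    inner_self_smul_inv_norm_sq_smul hs₁] at h
  exact h

/-- If `s₂ = 0` and `s₁ ≠ 0`, then `0 ⊕ P ⊆ W`. [folklore] -/
theorem inr_mem_of_snd_eq_zero (hs₂ : s.2 = 0) (hs₁ : s.1 ≠ 0) (y : P) :
    (((0 : P), y) : P × P) ∈ W :=
  inr_mem_of_inner_eq_zero W hW hs₁ (by rw [hs₂, inner_zero_right])

/-- If `s₁ = 0` and `s₂ ≠ 0`, then `P ⊕ 0 ⊆ W`. [folklore] -/
theorem inl_mem_of_fst_eq_zero (hs₁ : s.1 = 0) (hs₂ : s.2 ≠ 0) (y : P) :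
    ((y, (0 : P)) : P × P) ∈ W :=
  inl_mem_of_inner_eq_zero W hW hs₂ (by rw [hs₁, inner_zero_right])

end Orbit

/-! ### LEMMA P′: the dimension bound -/

omit [FiniteDimensional ℂ P] in
/-- A real multiple of a non-zero vector orthogonal to it is zero. [folklore] -/
theorem eq_zero_of_real_smul_mem_orthogonal {u : P} (hu : u ≠ 0) {t : ℝ}
    (ht : ⟪(t : ℂ) • u, u⟫_ℂ = 0) : t = 0 := by
  rw [inner_smul_left, Complex.conj_ofReal, inner_self_eq_coe_norm_sq, ← Complex.ofReal_mul,
    Complex.ofReal_eq_zero, mul_eq_zero] at ht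
  exact ht.resolve_right (pow_ne_zero 2 (norm_ne_zero_iff.2 hu))

/-- **LEMMA P′ (orbit of one vector).** Let `dim_ℂ P = n ≥ 2`, `W ⊆ U = P × P` a real subspace,
`s ∈ W`, `s ≠ 0`, and suppose the whole orbit `T_{|w⟩⟨v|} s` (`w, v ∈ P`) lies in `W`. Then
`dim_ℝ W ≥ 2n + 1`. Proof: if `s₂ = 0`, `W ⊇ 0 ⊕ P ∌ s`; symmetrically if `s₁ = 0`; otherwise
`W ⊇ (s₁^⊥ ⊕ 0) + (0 ⊕ s₂^⊥) + ℝ s`, of real dimension `(2n − 2) + (2n − 2) + 1 ≥ 2n + 1` — in each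
case an explicit injective real-linear map into `W` is written down. Geometric use (on paper): a flat
`B` of dimension `≤ n` glued along subflats with a common direction `s` would need
`dim_ℝ H₁(B₀, ℝ) ≥ 2n + 1 > 2 dim B`. [folklore] -/
theorem finrank_ge_of_orbit_subset (h2 : 2 ≤ finrank ℂ P) (W : Submodule ℝ (P × P)) {s : P × P}
    (hs : s ≠ 0) (hsW : s ∈ W) (hW : ∀ w v : P, offDiag (rankOne w v) s ∈ W) :
    2 * finrank ℂ P + 1 ≤ finrank ℝ W := by
  have hW' : ∀ w v : P, offDiag (rankOne w v) s ∈ W.toAddSubgroup := hW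
  have hn : finrank ℝ P = 2 * finrank ℂ P := finrank_real_of_complex P
  by_cases hs₂ : s.2 = 0
  · -- `W ⊇ 0 ⊕ P` and `s = (s₁, 0) ∈ W`, `s₁ ≠ 0`
    have hs₁ : s.1 ≠ 0 := by
      intro h; apply hs; exact Prod.ext h hs₂
    let g : (P × ℝ) →ₗ[ℝ] (P × P) :=
      { toFun := fun p ↦ (((p.2 : ℝ) : ℂ) • s.1, p.1)
        map_add' := fun p q ↦ by simp [add_smul]
        map_smul' := fun c p ↦ by
          simp only [Prod.smul_snd, Prod.smul_fst, smul_eq_mul, RingHom.id_apply, Prod.smul_mk,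
            Complex.ofReal_mul, mul_smul, Complex.coe_smul] }
    have hg_mem : ∀ p, g p ∈ W := by
      intro p
      have h1 : (((0 : P), p.1) : P × P) ∈ W := inr_mem_of_snd_eq_zero W.toAddSubgroup hW' hs₂ hs₁ p.1
      have h2 : (p.2 : ℝ) • s ∈ W := W.smul_mem _ hsW
      have : g p = (p.2 : ℝ) • s + ((0 : P), p.1) := by
        ext <;> simp [g, hs₂, Complex.coe_smul]
      rw [this]; exact W.add_mem h2 h1
    have hg_inj : Function.Injective (g.codRestrict W hg_mem) := by
      intro p q hpq
      have h := congrArg Subtype.val hpq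
      simp only [LinearMap.codRestrict_apply] at h
      have h1 : p.1 = q.1 := (Prod.mk.inj h).2
      have h2 : (((p.2 : ℝ) : ℂ) - ((q.2 : ℝ) : ℂ)) • s.1 = 0 := by
        rw [sub_smul, (Prod.mk.inj h).1, sub_self]
      rw [smul_eq_zero, sub_eq_zero, Complex.ofReal_inj] at h2
      exact Prod.ext h1 (h2.resolve_right hs₁)
    have := LinearMap.finrank_le_finrank_of_injective hg_inj
    rw [Module.finrank_prod, hn, Module.finrank_self] at this
    omega
  by_cases hs₁ : s.1 = 0
  · -- symmetric: `W ⊇ P ⊕ 0` and `s = (0, s₂)`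
    let g : (P × ℝ) →ₗ[ℝ] (P × P) :=
      { toFun := fun p ↦ (p.1, ((p.2 : ℝ) : ℂ) • s.2)
        map_add' := fun p q ↦ by simp [add_smul]
        map_smul' := fun c p ↦ by
          simp only [Prod.smul_snd, Prod.smul_fst, smul_eq_mul, RingHom.id_apply, Prod.smul_mk,
            Complex.ofReal_mul, mul_smul, Complex.coe_smul] }
    have hg_mem : ∀ p, g p ∈ W := by
      intro p
      have h1 : ((p.1, (0 : P)) : P × P) ∈ W := inl_mem_of_fst_eq_zero W.toAddSubgroup hW' hs₁ hs₂ p.1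
      have h2 : (p.2 : ℝ) • s ∈ W := W.smul_mem _ hsW
      have : g p = (p.2 : ℝ) • s + ((p.1, (0 : P)) : P × P) := by
        ext <;> simp [g, hs₁, Complex.coe_smul]
      rw [this]; exact W.add_mem h2 h1
    have hg_inj : Function.Injective (g.codRestrict W hg_mem) := by
      intro p q hpq
      have h := congrArg Subtype.val hpq
      simp only [LinearMap.codRestrict_apply] at h
      have h1 : p.1 = q.1 := (Prod.mk.inj h).1
      have h2 : (((p.2 : ℝ) : ℂ) - ((q.2 : ℝ) : ℂ)) • s.2 = 0 := by
        rw [sub_smul, (Prod.mk.inj h).2, sub_self]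
      rw [smul_eq_zero, sub_eq_zero, Complex.ofReal_inj] at h2
      exact Prod.ext h1 (h2.resolve_right hs₂)
    have := LinearMap.finrank_le_finrank_of_injective hg_inj
    rw [Module.finrank_prod, hn, Module.finrank_self] at this
    omega
  -- generic case: `s₁ ≠ 0 ≠ s₂`
  let K₁ : Submodule ℂ P := (ℂ ∙ s.1)ᗮ
  let K₂ : Submodule ℂ P := (ℂ ∙ s.2)ᗮ
  have hK₁ : finrank ℂ K₁ + 1 = finrank ℂ P := by
    have h := Submodule.finrank_add_finrank_orthogonal (ℂ ∙ s.1)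
    rw [finrank_span_singleton hs₁] at h
    simp only [K₁]; omega
  have hK₂ : finrank ℂ K₂ + 1 = finrank ℂ P := by
    have h := Submodule.finrank_add_finrank_orthogonal (ℂ ∙ s.2)
    rw [finrank_span_singleton hs₂] at h
    simp only [K₂]; omega
  let g : (K₁ × K₂ × ℝ) →ₗ[ℝ] (P × P) :=
    { toFun := fun p ↦ ((p.1 : P) + ((p.2.2 : ℝ) : ℂ) • s.1, (p.2.1 : P) + ((p.2.2 : ℝ) : ℂ) • s.2)
      map_add' := fun p q ↦ by
        simp only [Prod.fst_add, Prod.snd_add, Submodule.coe_add, Complex.ofReal_add, add_smul,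
          Prod.mk_add_mk]
        abel_nf
      map_smul' := fun c p ↦ by
        simp only [Prod.smul_fst, Prod.smul_snd, Submodule.coe_smul_of_tower, smul_eq_mul,
          RingHom.id_apply, Prod.smul_mk, Complex.ofReal_mul, mul_smul, smul_add, Complex.coe_smul] }
  have hg_mem : ∀ p, g p ∈ W := by
    intro p
    have h1 : (((p.1 : P), (0 : P)) : P × P) ∈ W :=
      inl_mem_of_inner_eq_zero W.toAddSubgroup hW' hs₂
        ((Submodule.mem_orthogonal_singleton_iff_inner_left).1 p.1.2)
    have h2' : (((0 : P), (p.2.1 : P)) : P × P) ∈ W :=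
      inr_mem_of_inner_eq_zero W.toAddSubgroup hW' hs₁
        ((Submodule.mem_orthogonal_singleton_iff_inner_left).1 p.2.1.2)
    have h3 : (p.2.2 : ℝ) • s ∈ W := W.smul_mem _ hsW
    have : g p = (((p.1 : P), (0 : P)) : P × P) + ((0 : P), (p.2.1 : P)) + (p.2.2 : ℝ) • s := by
      ext <;> simp [g, Complex.coe_smul]
    rw [this]; exact W.add_mem (W.add_mem h1 h2') h3
  have hg_inj : Function.Injective (g.codRestrict W hg_mem) := by
    rw [← LinearMap.ker_eq_bot, LinearMap.ker_codRestrict]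
    refine (Submodule.eq_bot_iff _).2 fun p hp ↦ ?_
    rw [LinearMap.mem_ker] at hp
    have hp1 : (p.1 : P) + ((p.2.2 : ℝ) : ℂ) • s.1 = 0 := (Prod.mk.inj hp).1
    have hp2 : (p.2.1 : P) + ((p.2.2 : ℝ) : ℂ) • s.2 = 0 := (Prod.mk.inj hp).2
    -- `t = 0`: the multiple `t • s₁ = -p.1` is orthogonal to `s₁`
    have ht : p.2.2 = 0 := by
      have hmem : ((p.2.2 : ℝ) : ℂ) • s.1 ∈ K₁ := by
        have : ((p.2.2 : ℝ) : ℂ) • s.1 = -(p.1 : P) := eq_neg_of_add_eq_zero_right hp1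
        rw [this]; exact K₁.neg_mem p.1.2
      exact eq_zero_of_real_smul_mem_orthogonal hs₁
        ((Submodule.mem_orthogonal_singleton_iff_inner_left).1 hmem)
    rw [ht, Complex.ofReal_zero, zero_smul, add_zero] at hp1 hp2
    ext <;> simp [hp1, hp2, ht]
  have := LinearMap.finrank_le_finrank_of_injective hg_inj
  rw [Module.finrank_prod, Module.finrank_prod, Module.finrank_self, finrank_real_of_complex,
    finrank_real_of_complex] at this
  omega

end WeilFamily

end Summit.Ventures.HSemireg
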